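import Summits.BirchSwinnertonDyer.Rank1Residual.X11a.AnomalousLineKummer
import Summits.BirchSwinnertonDyer.Rank1Residual.X11a.SelmerCompanionAtPKernelValued
import Literature.NumberTheory.EllipticCurves.SelmerImage
import HarnessLib

/-!
# Route (3e) SELMER COMPANION, XIX: at `v = p` with a SPLIT multiplicative curve and an anomalous
# good partner — the comparison index is `≤ p`, and strictness at `p`
# (class X11a = N7; cell `b2b-bsdres`, unit `b2b-bsdres-x11a`, gen 29)

HONEST FRAMING (run/shared/lean/b2b/bsd-rank1-residual/, verbatim in every file): the goal of the
cell is to DELETE the COMBINATION-SHAPED residual classes of the Birch–Swinnerton-Dyer formula for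
ALL analytic-rank `≤ 1` elliptic curves over `ℚ` — "full BSD formula for every rank `≤ 1` curve in
class `C`" assembled STRICTLY from published theorems — so that the rank-`≤ 1` remainder becomes
exactly the CONSTRUCTION-SHAPED classes, which are TYPED (missing-input `Prop`s), NOT attempted.
This is not "finishing BSD". CLASS-OWNERS.md: research routes; NO CLAIM BEYOND STATED CLASSES.
THEOREMS ONLY; nothing booked; no label moves. CONDITIONAL on the PUBLISHED named facts A41
(`Silverman1994_thmV53_corV54_tateUniformisation`, `hU`) and Tate's local Euler characteristic
(`localEulerPoincareCharacteristic ℚ_v`, Milne *ADT* I Thm. 2.8, `hEP`) where they are hypotheses.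

## What

`E = W`, `A` globally minimal over `ℚ`, `p` odd, `v ∋ p`, `θ : E[p] ≃ A[p]` `Γ_ℚ`-equivariant, `E`
MULTIPLICATIVE at `p`, `A` GOOD at `p` (so `A` is ordinary at `p`, `X11a/PartnerOrdinary`; when `E`
is SPLIT, `a_p(A) ≡ 1`: the ANOMALOUS case, where kind (v) of file VIII does not apply). The census
of gen 28 charges such a place `#𝓛_p(E) = p · #E(ℚ_p)[p] = p²` and found it to be the ONE lossy place
of `52` N7 residue cells at `p = 3` and `9` leaf cells at `p = 5`, all with a rank-one partner.

* `selmerLocalKer_eq_ker_and_apply` (any `K`, any `n`): the local condition `𝓢_E(W) ≤ H¹(K, E[n])`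
  is the kernel of `Λ_E = loc_E ∘ (H¹(K, E[n]) → H¹(K, E))`, `[φ] ↦ [pointsMap ∘ φ ∘ res]`.
* `relIndex_map_selmerLocalKer_le_of_mult_of_good_at_p` — **the comparison index at `p` is
  `ι_p(θ) = [θ_* 𝓢_p(E) : θ_* 𝓢_p(E) ∩ 𝓢_p(A)] ≤ p`**: `ι_p = #Λ_p(θ_* 𝓢_p(E))` (`𝓢_p(A) = ker Λ_p`);
  by file XVIII-c every class of `θ_* 𝓢_p(E)` restricts to `[f + ∂b₀] = [f]` with `f` valued in the
  line `C = A₁ ∩ A[p]`, and by file XVIII-b (Tate's Euler characteristic, the level calculus on the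
  formal group) at most `p` classes of `H¹(ℚ_v, A(K̄_v))` arise this way.
* `h1Equiv_eq_zero_of_selmer_of_strict_at_p` — **strictness at `p`**: if NO non-zero class of
  `Sel^(p)(A/ℚ)` becomes over `Γ_{ℚ_v}` the coboundary of a point `b ∈ A(K̄_v)` with `σb - b ∈ A₁`
  for all `σ` (`hstrict`: equivalently, no non-zero Selmer class of `A` is at `p` the local Kummer
  class of a point `P = pb ∈ A(ℚ_p)` whose reduction is `p`·(an `𝔽_p`-rational point); for a CLOSED
  rank-one partner generated by `κ(g)`: the certificate `g̃ ∉ pÃ(𝔽_p)`), then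
  `Sel^(p)(A) ∩ θ_* 𝓢_p(E) = 0`.

File XX assembles the count and the booking shape. References: [GreenbergLNM1716] §2 Props. 2.2,
2.4; [MazurRubin2004] §2.3; [SilvermanATAEC1994] V.5.3–5.4; [SilvermanAEC2009] VII.2.1, X.§4;
[MilneADT2006] I Thm. 2.8; HOME/b2b-bsdres-x11a/REPORT-g29.md.
-/

set_option autoImplicit false

noncomputable section

open scoped Classical NNReal

open WeierstrassCurve Literature.NumberTheory.EllipticCurves
  Literature.NumberTheory.GaloisRepresentations Field NumberField IsDedekindDomain
  IsDedekindDomain.HeightOneSpectrum Literature.NumberTheory.EllipticCurves.FormalGroupChart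
  Literature.NumberTheory.EllipticCurves.Rank1Residual
  Literature.NumberTheory.EllipticCurves.Rank1Residual.Typed

namespace Summit.BirchSwinnertonDyer.Rank1Residual.X11a.SelmerCompanion

section Local

variable {K : Type} [Field K] (W : WeierstrassCurve K) (E : Type) [Field E] [Algebra K E] (n : ℤ)

/-- **The local Selmer condition as a kernel, on cocycles.** `𝓢_E(W) ≤ H¹(K, E[n])` is the kernel
of the homomorphism `Λ_E = loc_E ∘ (H¹(K, E[n]) → H¹(K, E)) : H¹(K, E[n]) → H¹(E, E(K̄_E))`
(`selmerLocalKer_eq_comap`, `localRestrictionKer_eq_ker`), and `Λ_E [φ] = [σ ↦ pointsMap (φ (res σ))]`.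
Silverman, *AEC*, X.§4 (diagram (**)). [cite: SilvermanAEC2009, X.§4 diagram (**)] -/
theorem selmerLocalKer_eq_ker_and_apply :
    ∃ Λ : galH1Torsion W n →+ W.localH1 E,
      selmerLocalKer W E n = Λ.ker ∧
      ∀ ψ : contOneCocycles (discreteTopRep (absoluteGaloisGroup K) (geomTorsion W n)),
        ∃ ψ' : contOneCocycles (discreteTopRep (absoluteGaloisGroup E) (localPoints W E)),
          Λ (oneCocycleClass _ ψ) = oneCocycleClass _ ψ' ∧
          ∀ σ, ψ'.1 σ = pointsMap W E ((ψ.1 (resGal (K := K) E σ) : geomTorsion W n) : geomPoints W) := by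
  refine ⟨(W.localRestrictionHom E).comp (torsionH1ToH1 W n), ?_, fun ψ ↦ ?_⟩
  · rw [selmerLocalKer_eq_comap, localRestrictionKer_eq_ker, AddMonoidHom.comap_ker]
  · refine ⟨contOneCocycles.pullback (resGal (K := K) E)
        (resHomOfEquivariant (resGal (K := K) E) (pointsMap W E) (pointsMap_smul W E))
        (contOneCocycles.pullback (ContinuousMonoidHom.id (absoluteGaloisGroup K))
          (resHomOfEquivariant (ContinuousMonoidHom.id (absoluteGaloisGroup K))
            (geomTorsion W n).subtype (fun _ _ ↦ rfl)) ψ), ?_, fun σ ↦ rfl⟩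
    rw [AddMonoidHom.comp_apply]
    unfold torsionH1ToH1
    simp only [LinearMap.toAddMonoidHom_coe, ContinuousLinearMap.coe_coe]
    rw [map_oneCocycleClass, localRestrictionHom_oneCocycleClass]

end Local

variable (W A : WeierstrassCurve ℚ) [W.IsElliptic] [W.IsGloballyMinimal] [A.IsElliptic]
  [A.IsGloballyMinimal] (p : ℕ) [hp : Fact p.Prime]

set_option maxHeartbeats 800000 in
-- heavy instances at `ℚ_v`; not a search
/-- **The comparison index at `v = p` is at most `p`** for `E = W` MULTIPLICATIVE at the odd prime
`p` and a GOOD `p`-congruent partner `A` (both globally minimal over `ℚ`, `θ : E[p] ≃ A[p]`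
`Γ_ℚ`-equivariant): `[θ_* 𝓢_p(E) : θ_* 𝓢_p(E) ∩ 𝓢_p(A)] ≤ p`. (For `E` non-split the index is `1`,
file VIII; the content is the SPLIT case, where `A` is anomalous.) Granted A41 (`hU`) and Tate's
local Euler characteristic (`hEP`). See the module docstring.
[cite: GreenbergLNM1716, §2 Props. 2.2, 2.4] [cite: MilneADT2006, Ch. I §2, Thm. 2.8]
[cite: SilvermanATAEC1994, Ch. V Lemma 5.2 (c), Thm. 5.3, Cor. 5.4] -/
theorem relIndex_map_selmerLocalKer_le_of_mult_of_good_at_p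
    (hU : Silverman1994_thmV53_corV54_tateUniformisation.{0}) (hp2 : p ≠ 2)
    (θ : geomTorsion W (p : ℤ) ≃+ geomTorsion A (p : ℤ))
    (hθ : ∀ (σ : absoluteGaloisGroup ℚ) (P : geomTorsion W (p : ℤ)), θ (σ • P) = σ • θ P)
    {v : HeightOneSpectrum (𝓞 ℚ)} (hpv : (p : 𝓞 ℚ) ∈ v.asIdeal)
    (hEP : localEulerPoincareCharacteristic (v.adicCompletion ℚ))
    (hmult : W.HasMultiplicativeReductionAtPrime p) (hA : A.HasGoodReductionAtPrime p) :
    (selmerLocalKer A (v.adicCompletion ℚ) (p : ℤ)).relIndex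
      ((selmerLocalKer W (v.adicCompletion ℚ) (p : ℤ)).map (h1Equiv θ hθ).toAddMonoidHom) ≤ p := by
  have hpp : p.Prime := hp.out
  obtain ⟨w, hw⟩ := v.exists_spectralValuation
  haveI hV : (A.baseChange (AlgebraicClosure (v.adicCompletion ℚ))).IsIntegral w.integer :=
    ⟨⟨(integralModelInt A).map (algebraMap ℤ ↥w.integer),
      A.baseChange_eq_localIntModel_integer_baseChange⟩⟩
  have hΔA : ¬ (p : ℤ) ∣ minimalDiscriminantInt A :=
    A.not_dvd_minimalDiscriminantInt_of_hasGoodReductionAtPrime' p hA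
  have hθ' : ∀ (σ : absoluteGaloisGroup ℚ) (Q : geomTorsion A (p : ℤ)),
      θ.symm (σ • Q) = σ • θ.symm Q := fun σ Q ↦ by
    apply θ.injective
    rw [θ.apply_symm_apply, hθ, θ.apply_symm_apply]
  have hordA : ¬ (p : ℤ) ∣ A.frobeniusTrace p :=
    PartnerOrdinary.not_dvd_frobeniusTrace_of_equiv_of_hasMultiplicativeReduction hp2 hmult hA
      θ.symm hθ'
  -- the twist (α) of the line `C = A₁ ∩ A[p]` (file XVIII-c on the zero cocycle) and the set `S` of
  -- at most `p` classes of `H¹(ℚ_v, A(K̄_v))` of `C`-valued cocycles (file XVIII-b)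
  obtain ⟨-, -, -, -, -, -, -, -, ι, x₁, hx₁p, hx₁k, hx₁0, hιx₁⟩ :=
    exists_kernelValued_of_mult_of_good_at_p W A p hw hU hp2 θ hθ hpv hmult hA 0
      (by rw [oneCocycleClass_zero]; exact zero_mem _)
  obtain ⟨S, hSfin, hScard, hS⟩ := OrdinaryLine.exists_small_set_of_kernelValued_classes hw A hEP
    hpv hΔA hordA ⟨ι, x₁, hx₁p, hx₁k, hx₁0, hιx₁⟩
  -- `𝓢_p(A) = ker Λ_p`, so the index is `#Λ_p(θ_* 𝓢_p(E))`
  obtain ⟨Λ, hΛker, hΛapp⟩ := selmerLocalKer_eq_ker_and_apply A (v.adicCompletion ℚ) (p : ℤ)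
  rw [hΛker, AddSubgroup.relIndex_ker]
  refine le_trans (Nat.card_mono hSfin ?_) hScard
  rintro x hx
  obtain ⟨d, hd, rfl⟩ := AddSubgroup.mem_map.mp hx
  obtain ⟨c, hc, rfl⟩ := AddSubgroup.mem_map.mp hd
  obtain ⟨φ, rfl⟩ :=
    oneCocycleClass_surjective (discreteTopRep (absoluteGaloisGroup ℚ) (geomTorsion W (p : ℤ))) c
  change Λ (h1Equiv θ hθ (oneCocycleClass _ φ)) ∈ S
  rw [h1Equiv_oneCocycleClass]
  obtain ⟨ψ', hψ'eq, hψ'app⟩ := hΛapp (contOneCocycles.pullback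
    (ContinuousMonoidHom.id (absoluteGaloisGroup ℚ))
    (resHomOfEquivariant (ContinuousMonoidHom.id (absoluteGaloisGroup ℚ))
      (θ : geomTorsion W (p : ℤ) →+ geomTorsion A (p : ℤ)) hθ) φ)
  rw [hψ'eq]
  -- the E-side (file XVIII-c): `θ φ(res σ) = f σ + (σ b₀ - b₀)` with `f` `C`-valued
  obtain ⟨f, b₀, hfc, hf1, hfp, hfk, -, hφf, -⟩ :=
    exists_kernelValued_of_mult_of_good_at_p W A p hw hU hp2 θ hθ hpv hmult hA φ hc
  obtain ⟨φf, hφf'⟩ : ∃ φf : contOneCocycles (discreteTopRep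
      (absoluteGaloisGroup (v.adicCompletion ℚ)) (localPoints A (v.adicCompletion ℚ))),
      ∀ σ, φf.1 σ = f σ :=
    ⟨⟨⟨f, hfc⟩, fun σ τ ↦ by
      change f (σ * τ) = f σ + σ • f τ
      exact hf1 σ τ⟩, fun σ ↦ rfl⟩
  have hcl : oneCocycleClass _ ψ' = oneCocycleClass _ φf := by
    rw [← sub_eq_zero, ← oneCocycleClass_sub, oneCocycleClass_eq_zero_iff]
    refine ⟨b₀, fun σ ↦ ?_⟩
    rw [discreteTopRep_ρ_apply]
    change ψ'.1 σ - φf.1 σ = σ • b₀ - b₀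
    rw [hψ'app, h1Equiv_oneCocycleClass_apply, hφf σ, hφf']
    abel
  rw [hcl]
  exact hS φf (fun σ ↦ by rw [hφf']; exact hfp σ) (fun σ ↦ by rw [hφf']; exact hfk σ)

set_option maxHeartbeats 800000 in
-- heavy instances at `ℚ_v`; not a search
/-- **Strictness at `v = p`.** `E = W` MULTIPLICATIVE at the odd prime `p`, `A` GOOD at `p` (both
globally minimal over `ℚ`), `θ : E[p] ≃ A[p]` `Γ_ℚ`-equivariant, `w` the spectral valuation of `K̄_v`.
Suppose (`hstrict`) that every class of `Sel^(p)(A/ℚ)` which, restricted to `Γ_{ℚ_v}`, is the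
coboundary of a point `b ∈ A(K̄_v)` with `σb - b` in the kernel of reduction `A₁(K̄_v)` for all `σ`,
is zero. (Such a class is at `p` the local Kummer class of `P = pb ∈ A(ℚ_p)` with `P̃ = p·b̃`,
`b̃ ∈ Ã(𝔽_p)`; for a closed rank-one partner with `Sel^(p)(A) = ⟨κ(g)⟩` this says `g̃ ∉ pÃ(𝔽_p)`.)
Then **every class of `Sel^(p)(A) ∩ θ_* 𝓢_p(E)` is zero**: by file XVIII-c such a class restricts to
`[f + ∂b₀]` with `f` `C`-valued and `b₀ ∈ A[p]`, and being Selmer for `A` at `v` it is `[∂b₁]`; so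
the cocycle `θφ - ∂T₀` (same class) restricts to `∂(b₁ - b₀) = f`. Granted A41 (`hU`).
[cite: MazurRubin2004, §2.3] [cite: SilvermanAEC2009, X.§4 diagram (**), Prop. VII.2.1]
[cite: SilvermanATAEC1994, Ch. V Lemma 5.2 (c), Thm. 5.3, Cor. 5.4] -/
theorem h1Equiv_eq_zero_of_selmer_of_strict_at_p
    (hU : Silverman1994_thmV53_corV54_tateUniformisation.{0}) (hp2 : p ≠ 2)
    (θ : geomTorsion W (p : ℤ) ≃+ geomTorsion A (p : ℤ))
    (hθ : ∀ (σ : absoluteGaloisGroup ℚ) (P : geomTorsion W (p : ℤ)), θ (σ • P) = σ • θ P)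
    {v : HeightOneSpectrum (𝓞 ℚ)} (hpv : (p : 𝓞 ℚ) ∈ v.asIdeal)
    (hmult : W.HasMultiplicativeReductionAtPrime p) (hA : A.HasGoodReductionAtPrime p)
    {w : Valuation (AlgebraicClosure (v.adicCompletion ℚ)) ℝ≥0}
    (hw : ∀ x, (w x : ℝ) =
      spectralNorm (v.adicCompletion ℚ) (AlgebraicClosure (v.adicCompletion ℚ)) x)
    [hV : (A.baseChange (AlgebraicClosure (v.adicCompletion ℚ))).IsIntegral w.integer]
    (hstrict : ∀ ψ : contOneCocycles (discreteTopRep (absoluteGaloisGroup ℚ) (geomTorsion A (p : ℤ))),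
      oneCocycleClass _ ψ ∈ A.selmerGroup (p : ℤ) →
      ∀ b : localPoints A (v.adicCompletion ℚ),
        (∀ σ : absoluteGaloisGroup (v.adicCompletion ℚ), pointsMap A (v.adicCompletion ℚ)
          ((ψ.1 (resGal (K := ℚ) (v.adicCompletion ℚ) σ) : geomTorsion A (p : ℤ)) : geomPoints A)
            = σ • b - b) →
        (∀ σ : absoluteGaloisGroup (v.adicCompletion ℚ),
          ((σ • b - b : localPoints A (v.adicCompletion ℚ)) :
            (A.baseChange (AlgebraicClosure (v.adicCompletion ℚ))).toAffine.Point) ∈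
            kernel w (A.baseChange (AlgebraicClosure (v.adicCompletion ℚ)))) →
        oneCocycleClass _ ψ = 0)
    {c : galH1Torsion W (p : ℤ)} (hc : c ∈ selmerLocalKer W (v.adicCompletion ℚ) (p : ℤ))
    (hsel : h1Equiv θ hθ c ∈ A.selmerGroup (p : ℤ)) :
    h1Equiv θ hθ c = 0 := by
  have hpp : p.Prime := hp.out
  have hn : (p : ℤ) ≠ 0 := by exact_mod_cast hpp.ne_zero
  obtain ⟨φ, rfl⟩ :=
    oneCocycleClass_surjective (discreteTopRep (absoluteGaloisGroup ℚ) (geomTorsion W (p : ℤ))) c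
  -- the E-side (file XVIII-c)
  obtain ⟨f, b₀, -, -, -, hfk, hb₀p, hφf, -⟩ :=
    exists_kernelValued_of_mult_of_good_at_p W A p hw hU hp2 θ hθ hpv hmult hA φ hc
  -- `b₀` is the image of a `p`-torsion point `T₀ ∈ A[p](ℚ̄)`
  set eA := A.torsionPointsEquiv (p : ℤ) (E := (v.adicCompletion ℚ)) hn with heA
  set T₀ : geomTorsion A (p : ℤ) :=
    eA.symm ⟨b₀, (Submodule.mem_torsionBy_iff _ _).mpr hb₀p⟩ with hT₀
  have hT₀b : pointsMap A (v.adicCompletion ℚ) (T₀ : geomPoints A) = b₀ := by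
    rw [hT₀, heA, A.pointsMap_torsionPointsEquiv_symm (p : ℤ) hn]
  -- the cocycle `ψ = θφ - ∂T₀` of `A[p]`, of class `θ_* c`
  set ψθ := contOneCocycles.pullback (ContinuousMonoidHom.id (absoluteGaloisGroup ℚ))
    (resHomOfEquivariant (ContinuousMonoidHom.id (absoluteGaloisGroup ℚ))
      (θ : geomTorsion W (p : ℤ) →+ geomTorsion A (p : ℤ)) hθ) φ with hψθ
  obtain ⟨π, hπ⟩ := exists_contOneCocycles_apply_eq_smul_sub (G := absoluteGaloisGroup ℚ) T₀
    (A.isOpen_stabilizer_geomTorsion (p : ℤ) T₀)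
  have hπ0 : oneCocycleClass _ π = 0 :=
    (oneCocycleClass_eq_zero_iff _ _).mpr ⟨T₀, fun σ ↦ by rw [hπ σ, discreteTopRep_ρ_apply]⟩
  have hcls : oneCocycleClass _ (ψθ - π) = h1Equiv θ hθ (oneCocycleClass _ φ) := by
    rw [oneCocycleClass_sub, hπ0, sub_zero, h1Equiv_oneCocycleClass]
  -- its transported restriction is `f`
  have hψf : ∀ σ : absoluteGaloisGroup (v.adicCompletion ℚ), pointsMap A (v.adicCompletion ℚ)
      (((ψθ - π).1 (resGal (K := ℚ) (v.adicCompletion ℚ) σ) : geomTorsion A (p : ℤ)) :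
        geomPoints A) = f σ := by
    intro σ
    have h1 : (ψθ - π).1 (resGal (K := ℚ) (v.adicCompletion ℚ) σ) =
        ψθ.1 (resGal (K := ℚ) (v.adicCompletion ℚ) σ) - π.1 (resGal (K := ℚ) (v.adicCompletion ℚ) σ) :=
      rfl
    rw [h1, hψθ, h1Equiv_oneCocycleClass_apply, hπ, AddSubgroupClass.coe_sub, map_sub, hφf,
      AddSubgroupClass.coe_sub, map_sub,
      Literature.NumberTheory.EllipticCurves.AddSubgroup.torsionBy.coe_smul, pointsMap_smul, hT₀b]
    abel
  -- it is Selmer for `A` at `v`: `f = ∂b₁`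
  have hselv : oneCocycleClass _ (ψθ - π) ∈ selmerLocalKer A (v.adicCompletion ℚ) (p : ℤ) := by
    rw [hcls]; exact ((mem_selmerGroup_iff A _ _).mp hsel).1 v
  rw [selmerLocalKer, oneCocycleClass_mem_resKer_iff] at hselv
  obtain ⟨b₁, hb₁⟩ := hselv
  have hb₁' : ∀ σ : absoluteGaloisGroup (v.adicCompletion ℚ), pointsMap A (v.adicCompletion ℚ)
      (((ψθ - π).1 (resGal (K := ℚ) (v.adicCompletion ℚ) σ) : geomTorsion A (p : ℤ)) :
        geomPoints A) = σ • b₁ - b₁ := fun σ ↦ hb₁ σ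
  -- strictness
  rw [← hcls]
  refine hstrict (ψθ - π) (by rw [hcls]; exact hsel) b₁ hb₁' (fun σ ↦ ?_)
  rw [← hb₁' σ, hψf σ]
  exact hfk σ

end Summit.BirchSwinnertonDyer.Rank1Residual.X11a.SelmerCompanion

end
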